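import Mathlib
import Literature.MathematicalPhysics.QuantumFieldTheory.Balaban1983to89.B9Eq3169Comb

/-! # `Balaban1983to89.B9Eq3169MuN` — (3.169)/(3.185) in the NON-ABELIAN (vector) model: 𝔤 a real normed /
# inner-product space with ISOMETRIC transports R(V(b)) (R(U)X = UXU⁻¹ preserves the Hilbert–Schmidt norm, p. 390);
# the locality of E = I + D̄μ(·) as NUMBERS — ‖E(B)(b)‖ ≤ (1 + 4ℓ)·sup‖B‖, and for 𝔤 ≅ ℝⁿ the scalar-entry matrix over
# bonds × colours with range D + 1 and row ℓ¹-sums ≤ (1 + 4ℓ)√n (combs: r = L, m = (1 + 4d(L − 1))√n); the (3.185)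
# data in DOMINATION form (the block-norm reading of |C^{(k)}(Λ; y, y′)|) with its edge into `B9.Thm315Printed`; and
# BOND CHARTS repairing an over-determination in the b09 edges of gen 12/13 — kernel-checked [folklore] linear algebra
# over the printed definitions

CITATION HEADER (lean-in-tree rule).  Paper sub-cell `b2b-balaban-b09` (gen 12, journal claim B9-EQ3169-MUN, cell
pub-balaban) on T. Bałaban, *Propagators for lattice gauge theories in a background field*, Commun. Math. Phys. **99**
(1985) 389–434 [`Balaban1985BackgroundPropagators`] (= B9; held `paper:balaban1985-cmp99-background-propagators`;
journal page = PDF page + 388), p. 390 [PDF 2], p. 393 [PDF 5], Sect. E pp. 427–432 [PDF 39–44]; with [5] = T. Bałaban,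
*Averaging operations for lattice gauge theories*, Commun. Math. Phys. **98** (1985) 17–51 [`Balaban1985Averaging`]
p. 24 [PDF 8] THROUGH THE TREE ONLY (`B9Eq3169Comb.BondModel.frame`, typed and cited there).  Renders
`b2b-balaban-ref1/pages/1985-cmp99-background-propagators/…-p002-x2.png`, `…-p005-x2.png`, `…-p039-x2.png`,
`…-p040-x2.png`, `…-p042-x2.png`, `…-p044-x2.png` READ AS IMAGES for this module (not from an OCR layer).  USED BY NAME,
nothing restated: `B9Eq3169Mu.hol` / `trSum` / `cod` / `AxialFrame` (+ `.bavg`, `.mu`, `.dress`, `.dressLin`,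
`.dress_congr`, `.InAx`) / `Emat` / `Emat_range` / `sum_abs_Emat_le` (gen 12), `B9Eq3169Comb.BondModel` (+ `.frame`,
`.length_frame_Γ_le`, `.frame_hdiam`, `.frame_hbond`, `.frame_hin`, `.isPseudoDist_dist`) (gen 12, claim
B9-EQ3169-COMB), `B9Thm315Decay.Rep3185` / `Hyp3185` / `decay_3187_of_3185` / `bound_of_rep3185` (gen 11),
`B9.Geometry` / `SiteKernel` / `Backgrounds.Reg335` / `Reg336` / `Thm315Printed` (r1), `B4Sect5Torus.IsPseudoDist`,
Mathlib's `LinearIsometryEquiv`, `LinearEquiv.isometryOfInner`, `EuclideanSpace`.  No existing module is modified.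

WHAT IS PRINTED (verbatim).
* B9 p. 390 [PDF 2]: *"We will use the notations, the methods and the results of [1–5]. Let us remark only that in this
  paper a norm |X| of a N × N matrix means the Hilbert–Schmidt norm: |X|² = tr X*X."* … *"Let us recall that
  R(U)X = UXU⁻¹. This operation will be widely used in this paper, as it was in [5], …"* … *"Let us introduce covariant
  derivatives. For a matrix valued function A defined at points of the lattice we put (D^η_{U₀}A)(b) =
  η⁻¹(R(U₀(b))A(b₊) − A(b₋)),"*.
* B9 p. 393 [PDF 5], the one-step line of (3.18)–(3.19): *"(Q′(V)λ)(y) = Σ_{x∈B(y)} L^{−d}R(V(Γ_{y,x}))λ(x),"* (block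
  contours Γ_{y,x}: [5] p. 24, typed as `B9Eq3169Comb.BondModel.frame`, quoted there).
* B9 p. 427 [PDF 39]: *"We assume that Λ ⊂ Λ_k = Ω_k^{(k)}, Λ is a union of big blocks, and a distance between Λ and
  Λ_kᶜ is bigger than RM."*; (3.155): *"… g is an arbitrary Lie algebra valued function defined at bonds of Λ."*;
  p. 428 [PDF 40]: *"This form is considered on the subspace {B: B = 0 on Λᶜ, B = 0 on ⋃_{y∈Λ′}Ax(y), Q₁B = 0}."*
* B9 p. 430 [PDF 42], (3.168)–(3.169) (typed in `B9Eq3169Mu`, quoted in full there): *"… we perform the gauge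
  transformation B → B + D̄μ. This gives us the following μ-integral to calculate ∫dμ δ(Q′₁μ)δ_{Ax}(B + D̄μ)G(μ).
  (3.168) The δ-functions above determine μ uniquely as a linear function of B. …"* *"This implies μ(y) =
  Q′(R_y(V)B)(Γ_{y,·}), μ(x) = R(V(Γ_{x,y}))Q′(R_y(V)B)(Γ_{y,·}) − R(V(Γ_{x,y}))(R_y(V)B)(Γ_{y,x}), x∈B(y), x ≠ y.
  (3.169) We denote the linear function defined by the above formulas by μ(B)."*
* B9 p. 432 [PDF 44]: *"C^{(k)}(Λ) = (I + D̄μ)QG̃₂Q*(I + μ*D̄*). (3.185) … The formula (3.185) implies immediately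
  bounds and an exponential decay. Thus we get Theorem 3.15. For Mα₀ sufficiently small the propagator C^{(k)}(Λ) is
  given by the formula (3.185), and satisfies the bound |C^{(k)}(Λ; y, y′)| ≤ B₀e^{−δ₀|y−y′|}, y, y′ ∈ Λ (3.187) with
  the constants B₀, δ₀ depending on d and L only."*

THE READING (typed objects; every choice is recorded in the cell's DIVERGENCE D-b09.42 — a typing, not a claim about
the print; it EXTENDS readings (a)–(f) of D-b09.40 (gen 12, `B9Eq3169Mu`) and D-b09.41 (gen 12, `B9Eq3169Comb`) to the
print's non-abelian case and closes residual (iii) of GAPS C-B9-57).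
(a) 𝔤 AND THE TRANSPORTS.  In the print the fields B, μ, g are 𝔤-valued (𝔤 ⊂ the N × N matrices), |X| is the
    Hilbert–Schmidt norm (p. 390) and the transports act by R(U)X = UXU⁻¹ — an ISOMETRY of (𝔤, |·|) for unitary U
    (|UXU⁻¹|² = tr (UXU⁻¹)*(UXU⁻¹) = tr X*X).  Typed (§C): 𝔤 is ANY real normed space and the bond transports are
    linear isometries `T b : 𝔤 ≃ₗᵢ[ℝ] 𝔤`, entering the (3.169) calculus of `B9Eq3169Mu` (which takes `𝔤 ≃ₗ[ℝ] 𝔤`)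
    through `Ri T b := (T b).toLinearEquiv`; the dictionary from the gen-12 vocabulary — linear transports R preserving
    an inner product of 𝔤 — is `RiOfInner` (`LinearEquiv.isometryOfInner`) with `Ri (RiOfInner R h) = R`.  For the
    scalar-entry statements 𝔤 is COORDINATISED as ℝⁿ = `EuclideanSpace ℝ (Fin n)`, n = dim_ℝ 𝔤 (for su(N): n = N² − 1;
    an orthonormal basis for the invariant inner product identifies the two isometrically — the identification is the
    instance-maker's, T is taken on ℝⁿ directly); "colours" below = the coordinate index `Fin n`.  The abelian /
    scalar model of gen 12 (𝔤 = ℝ, R(V(b)) = ±1) is the case n = 1.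
(b) THE KERNEL AND ITS SIZE.  C^{(k)}(Λ) acts on 𝔤-valued bond functions, so its kernel C^{(k)}(Λ; y, y′) over a pair
    of bonds is a BLOCK (an endomorphism of 𝔤; n × n scalar entries in coordinates) and (3.187)'s |C^{(k)}(Λ; y, y′)|
    is a norm of that block.  r1's `B9.SiteKernel.ker : Cfg → Site → Site → ℝ` is one real number per site pair, and
    gen 11's `B9Thm315Decay.Rep3185` ties it to the factorised matrix by an IDENTITY `Ck.ker U (e p) (e q) =
    (E S Eᵀ) p q` (one entry).  Typed here (§A, `Rep3185Dom`): the DOMINATION |Ck.ker U y y′| ≤ K·|(E S Eᵀ)(p, q)| for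
    SOME index pair (p, q) charted to (y, y′) — satisfied by the Hilbert–Schmidt norm of an n × n block with K = n
    (`exists_hs_le_card_mul_entry`: HS ≤ order × largest entry), by the operator norm (≤ HS), by any fixed entry or by
    the identity reading (K = 1, `rep3185Dom_of_rep3185`).  The (3.187) decay then follows with B₀ = K·B₁e^{2δ₁r}m²,
    δ₀ = δ₁ (`bound_of_rep3185Dom`, through gen 11's `decay_3187_of_3185`), and uniform domination data `Hyp3185Dom`
    give r1's `B9.Thm315Printed` (`thm315Printed_of_3185Dom`).
(c) CHARTS (self-audit of the b09 edge chain).  The sites of r1's `B9.Geometry` are abstract; the (3.185) data chart a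
    finite index set P into them (e : P → Site) and measure distances by `unitDist (e p) (e q)`.  The edges
    `B9Eq3169Mu.rep3185_of_eq3169` (gen 12) and `B9Eq3169Comb.BondModel.rep3185_of_comb` / `B9Eq3169Comb.rep3185_star`
    (gen 12, claim B9-EQ3169-COMB) FORCE the chart e = σ ∘ (b ↦ b₋) through the initial points; their factorisation
    hypothesis `hfac : ∀ p q, Ck.ker U (σ p₋) (σ q₋) = (E S Eᵀ) p q` then IDENTIFIES the entries of the bond-indexed
    matrix E S Eᵀ over all bond pairs with common initial points (`srcChart_forces_eq`; for d ≥ 2, d bonds leave each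
    site) — those theorems are valid, but their hypothesis is satisfiable only by kernels determined by initial points,
    which the print's bond-indexed C^{(k)}(Λ) ((3.155): *"defined at bonds of Λ"*; (3.187)'s y, y′ range over bonds,
    cf. the cell's cross-read note R2 on `B9Thm315Decay`) is not.  REPAIR (§B, and §C for the vector model): the edges
    are re-proved for an ARBITRARY BOND CHART χ : Bond → Site with `unitDist (χ b) (χ b′) = ρ(b₋, b′₋)` (the reading of
    |y − y′| for bonds as the distance of their initial points, D-b09.40 (d)); injective charts exist as soon as the
    site type holds the bonds, and then `hfac` is ONE equation per bond pair, as printed.  gen 12's statement is the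
    special case χ = σ ∘ (b ↦ b₋) (an `example` in §B: a definitional identity).  With `inΛ` := the image of
    χ, COVERAGE IS AUTOMATIC for every bond convention and every d (gen 12/13 needed `hcov`, discharged only for the
    star convention with d ≥ 1).  In the vector model P = Bond × Fin n is charted by (b, i) ↦ χ b (n colours over each
    bond — here the domination form (b) is essential: an identity reading would again identify the n² entries of a
    block).
(d) S OVER P.  S = QG̃₂Q* is taken as a real P × P matrix (bond–colour entries) with the random-walk bound
    |S(p, q)| ≤ B₁e^{−δ₁|χ p₋ − χ q₋|} entrywise — a HYPOTHESIS exactly as in gen 11–13 (G-B9-10 OPEN: its derivation is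
    B9 (3.176)–(3.184) with [13], not typed), and the factorisation (3.185) itself stays a hypothesis (inside `hdom`).
(e) THE CONSTANTS.  Range: E((b, i), (b′, j)) ≠ 0 ⇒ ρ(b₋, b′₋) ≤ D + 1 (`EmatN_range`; = L on the combs,
    `comb_EmatN_range`) — the SAME as in the scalar model, by the same locality (`dress_eq_zero_of_vanish`: E(B)(b)
    depends only on B(b) and B on the axial bonds of the blocks of b₊, b₋, for ANY 𝔤 and ANY linear transports).  Rows:
    at operator level ‖E(B)(b)‖ ≤ ‖B(b)‖ + ‖μ(b₊)‖ + ‖μ(b₋)‖ ≤ (1 + 4ℓ)·sup‖B‖ exactly as for n = 1 (`norm_dress_le`,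
    from ‖R(V(Γ))v‖ = ‖v‖, ‖(R_y(V)B)(Γ)‖ ≤ |Γ|·sup‖B‖, ‖μ(x)‖ ≤ 2ℓ·sup‖B‖); for the scalar entries the ℓ¹ row mass
    is obtained by duality against sign patterns s ∈ {±1}^P, whose bond functions have Euclidean size ≤ √n per bond,
    whence Σ_q |E(p, q)| ≤ (1 + 4ℓ)√n (`sum_abs_EmatN_le`; (1 + 4d(L − 1))√n on the combs).  So B₀ =
    K·B₁e^{2δ₁r}(1 + 4ℓ)²n, δ₀ = δ₁: *"depending on d and L only"* up to the inputs B₁, δ₁ of the random-walk bound and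
    the dimension n of 𝔤 (a constant of the model).  The √n is an artefact of passing from operator norms to scalar
    entries with ℓ¹ rows (convenient, not optimal — D-b09.40 (f)); at the level of OPERATOR-NORMED BLOCK
    ENTRIES it disappears: the separate leaf `B9Eq3187Op` (gen 12; GAPS C-B9-63) types the operator entries
    Eop(b, b′) ∈ End 𝔤 of E with range D + 1 and row mass Σ_{b′}‖Eop(b, b′)‖ ≤ 1 + 4ℓ and runs the decay on the
    norm-majorant matrices (B₀ = K·B₁e^{2δ₁r}(1 + 4ℓ)², no n).

WHAT IS PROVED ([folklore] linear algebra over the (3.169) calculus; standard axioms only).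
§A `Rep3185Dom`, `exists_hs_le_card_mul_entry`, `rep3185Dom_of_rep3185` (K = 1), `bound_of_rep3185Dom`,
`Hyp3185Dom`, `hyp3185Dom_of_hyp3185`, `thm315Printed_of_3185Dom` (the edge into r1's typed Theorem 3.15).
§B `isPseudoDist_chart`; `srcChart_forces_eq` (kernel witness of the over-determination (c)); the scalar edges with
a bond chart `rep3185_of_eq3169_chart` (→ `Rep3185 … (D + 1) (1 + 4ℓ)`; gen 12's edge is its special case χ =
σ ∘ (b ↦ b₋), an `example`), `rep3185Dom_of_eq3169_chart`; on the combs `comb_rep3185_of_chart` (→ `Rep3185 … L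
(1 + 4d(L − 1))` for `inΛ` = image χ, no coverage hypothesis), `comb_bound_3187_of_chart`.
§C `dress_eq_zero_of_vanish` (locality for any 𝔤); isometric transports `Ri`, `norm_hol`, `norm_hol_symm`,
`norm_trSum_le`, `norm_bavg_le`, `norm_mu_le` (‖μ(B)(x)‖ ≤ 2ℓ·sup‖B‖), `norm_dress_le` (‖E(B)(b)‖ ≤ (1 + 4ℓ)·sup‖B‖);
the dictionary `RiOfInner`, `Ri_RiOfInner`, `norm_dress_le_of_inner`, `norm_mu_le_of_inner`; in coordinates ℝⁿ:
`norm_le_sqrt_of_abs_le_one`, `unitB`, `unitB_apply`, `unitB_decomp`, the scalar-entry matrix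
`EmatN` with `dress_coord` (E(B) = EmatN·B), `EmatN_ne_zero`, `EmatN_range`, `sum_abs_le_of_dual`, `sum_abs_EmatN_le`,
and the non-abelian edge `rep3185Dom_of_eq3169N` (→ `Rep3185Dom … (D + 1) ((1 + 4ℓ)√n) K`).
§D on the combs of `B9Eq3169Comb`: `comb_EmatN_range` (r = L), `comb_sum_abs_EmatN_le` (m = (1 + 4d(L − 1))√n),
`comb_rep3185Dom_N`, `comb_bound_3187_N`.

v1.1 (DOCSTRING-ONLY over v1 p185112; code byte-identical): ref5-g29 XREAD R1 (GAPS C-ref5-144) — the docstring of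
`comb_bound_3187_N` printed the dimension factor as «N»; it is n = dim 𝔤 (the theorem's `(n : ℝ)`), corrected; pointer
sentences updated (owed pointers delivered; block form in `B9Eq3187Op`).

WHAT IS NOT PROVED.  The factorisation (3.185) and the random-walk bound of QG̃₂Q* (G-B9-10 OPEN; hypotheses `hfac` /
`hdom` / `hS`); the identification 𝔤 ≅ ℝⁿ by an orthonormal basis and the unitarity of the print's V (the instance
supplies `T`, or R with `RiOfInner`); operator-level (block) decay without coordinates (only the operator-norm row bound
`norm_dress_le` is typed HERE; the decay is run on scalar entries — see `B9Eq3187Op` for the block form); optimality of √n and of 1 + 4ℓ; the j-fold contours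
Γ^{(j)}, torus identifications, incoming boundary bonds (as D-b09.40/41).  The docstring pointers from `B9Eq3169Mu` §4 and
`B9Eq3169Comb` §4 to the bond-chart edges of §B owed at v1 are DELIVERED (`B9Eq3169Mu` v1.2, `B9Eq3169Comb` v1.1,
docstring-only; GAPS C-B9-61/62); `B9Thm315Decay` is deliberately NOT revised (the domination form lives here; its cross-read duties R1–R3 ride
with its next substantive revision, GAPS C-B9-55).  Value = kernel certificate that Theorem 3.15's locality constants
survive the passage to the print's non-abelian, bond-indexed, block-normed setting as explicit functions of d, L and
dim 𝔤, plus an honest repair of the seat's own chart hypothesis — typed skeleton / located gap, NOT summit progress. -/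

namespace Literature.MathematicalPhysics.QuantumFieldTheory.Balaban1983to89.B9Eq3169MuN

open Finset
open scoped Matrix
open B4Sect5Torus (IsPseudoDist)
open B6Elimination (BlockClosed)
open B9Eq3169Mu
open B9Eq3169Comb (BondModel)

/-! ## §A  The (3.185) data in DOMINATION form and the edge into `B9.Thm315Printed` -/

section Dom

/-- THE (3.185) DATA AT ONE CONFIGURATION U IN DOMINATION FORM: a finite index set P (bonds, or bonds × colours)
with a chart e into the sites, on which |y − y′| is a pseudo-distance; the random-walk bound |S(p,q)| ≤
B₁e^{−δ₁|e p − e q|} (HYPOTHESIS, G-B9-10); the locality of E = I + D̄μ(·) (range ≤ r, row ℓ¹-sums ≤ m); and, instead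
of the kernel IDENTITY of `B9Thm315Decay.Rep3185`, the DOMINATION |C^{(k)}(Λ; y, y′)| ≤ K·|(ESEᵀ)(p, q)| for some
index pair (p, q) over (y, y′) — the reading under which the print's |·| of the 𝔤-valued (block) kernel is any norm
dominated by K × its largest entry. [cite: Balaban1985BackgroundPropagators, (3.185)–(3.187) p.432 + (3.169) p.430] -/
def Rep3185Dom (g : B9.Geometry) (B : B9.Backgrounds) (Ck : B9.SiteKernel g B) (inΛ : g.Site → Prop)
    (unitDist : g.Site → g.Site → ℝ) (U : B.Cfg) (δ₁ B₁ r m K : ℝ) : Prop :=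
  ∃ (P : Type) (_ : Fintype P) (e : P → g.Site) (E S : Matrix P P ℝ),
    IsPseudoDist (fun p q => unitDist (e p) (e q)) ∧
    (∀ p q, |S p q| ≤ B₁ * Real.exp (-(δ₁ * unitDist (e p) (e q)))) ∧
    (∀ p q, E p q ≠ 0 → unitDist (e p) (e q) ≤ r) ∧
    (∀ p, ∑ q, |E p q| ≤ m) ∧
    (∀ y y', inΛ y → inΛ y' → ∃ p q, e p = y ∧ e q = y' ∧ |Ck.ker U y y'| ≤ K * |(E * S * Eᵀ) p q|)

/-- WHY DOMINATION WITH A CONSTANT K (reading (b) of the header): the print's |X| is the Hilbert–Schmidt norm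
(p. 390), and the Hilbert–Schmidt size of a finite block is at most (its order) × (its largest entry) — so a block
norm is dominated by K·|one entry| with K = the order of the block. [cite: Balaban1985BackgroundPropagators, p.390] -/
theorem exists_hs_le_card_mul_entry {ι : Type} [Fintype ι] [Nonempty ι] (F : Matrix ι ι ℝ) :
    ∃ i j, Real.sqrt (∑ a, ∑ b, F a b ^ 2) ≤ Fintype.card ι * |F i j| := by
  obtain ⟨⟨i, j⟩, -, hmax⟩ :=
    Finset.exists_max_image (Finset.univ : Finset (ι × ι)) (fun p => |F p.1 p.2|) Finset.univ_nonempty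
  refine ⟨i, j, ?_⟩
  have h1 : ∑ a, ∑ b, F a b ^ 2 ≤ ∑ _a : ι, ∑ _b : ι, |F i j| ^ 2 :=
    Finset.sum_le_sum fun a _ => Finset.sum_le_sum fun b _ =>
      sq_le_sq.mpr (by rw [abs_abs]; exact hmax (a, b) (Finset.mem_univ _))
  have h2 : ∑ _a : ι, ∑ _b : ι, |F i j| ^ 2 = ((Fintype.card ι : ℝ) * |F i j|) ^ 2 := by
    simp only [Finset.sum_const, Finset.card_univ, nsmul_eq_mul]
    ring
  calc Real.sqrt (∑ a, ∑ b, F a b ^ 2)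
      ≤ Real.sqrt (((Fintype.card ι : ℝ) * |F i j|) ^ 2) := Real.sqrt_le_sqrt (h1.trans_eq h2)
    _ = Fintype.card ι * |F i j| := Real.sqrt_sq (by positivity)

/-- The identity form of gen 11 is the domination form with K = 1. [folklore] -/
theorem rep3185Dom_of_rep3185 {g : B9.Geometry} {B : B9.Backgrounds} {Ck : B9.SiteKernel g B}
    {inΛ : g.Site → Prop} {unitDist : g.Site → g.Site → ℝ} {U : B.Cfg} {δ₁ B₁ r m : ℝ}
    (h : B9Thm315Decay.Rep3185 g B Ck inΛ unitDist U δ₁ B₁ r m) :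
    Rep3185Dom g B Ck inΛ unitDist U δ₁ B₁ r m 1 := by
  obtain ⟨P, instP, e, E, S, hcov, hρ, hfac, hS, hEr, hE1⟩ := h
  refine ⟨P, instP, e, E, S, hρ, hS, hEr, hE1, fun y y' hy hy' => ?_⟩
  obtain ⟨p, rfl⟩ := hcov y hy
  obtain ⟨q, rfl⟩ := hcov y' hy'
  exact ⟨p, q, rfl, rfl, by rw [hfac, one_mul]⟩

/-- (3.185) data in domination form ⇒ (3.187) at U with δ₀ = δ₁ and B₀ = K·B₁e^{2δ₁r}m²
(`B9Thm315Decay.decay_3187_of_3185` on the index set, read on the sites through the chart).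
[cite: Balaban1985BackgroundPropagators, (3.185)–(3.187) p.432] -/
theorem bound_of_rep3185Dom {g : B9.Geometry} {B : B9.Backgrounds} {Ck : B9.SiteKernel g B}
    {inΛ : g.Site → Prop} {unitDist : g.Site → g.Site → ℝ} {U : B.Cfg} {δ₁ B₁ r m K : ℝ}
    (hB₁ : 0 ≤ B₁) (hδ₁ : 0 ≤ δ₁) (hK : 0 ≤ K) (h : Rep3185Dom g B Ck inΛ unitDist U δ₁ B₁ r m K) :
    ∀ y y', inΛ y → inΛ y' →
      |Ck.ker U y y'| ≤ K * (B₁ * Real.exp (2 * δ₁ * r) * m * m) * Real.exp (-(δ₁ * unitDist y y')) := by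
  intro y y' hy hy'
  obtain ⟨P, instP, e, E, S, hρ, hS, hEr, hE1, hdom⟩ := h
  obtain ⟨p, q, rfl, rfl, hle⟩ := hdom y y' hy hy'
  refine hle.trans ?_
  calc K * |(E * S * Eᵀ) p q|
      ≤ K * (B₁ * Real.exp (2 * δ₁ * r) * m * m * Real.exp (-(δ₁ * unitDist (e p) (e q)))) :=
        mul_le_mul_of_nonneg_left
          (B9Thm315Decay.decay_3187_of_3185 (fun p q => unitDist (e p) (e q)) hρ E S hB₁ hδ₁ hS hEr hE1 p q) hK
    _ = K * (B₁ * Real.exp (2 * δ₁ * r) * m * m) * Real.exp (-(δ₁ * unitDist (e p) (e q))) := by ring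

/-- THE DOMINATION-FORM DATA UNDER THE QUANTIFIER PREFIX OF THE TYPED THEOREM 3.15 (as `B9Thm315Decay.Hyp3185`):
constants (δ₁, B₁, r, m, K) uniform in the instance i and the configuration U.
[cite: Balaban1985BackgroundPropagators, Thm 3.15 p.432] -/
def Hyp3185Dom {I : Type} (c35 : ℝ) (geo : I → B9.Geometry) (bg : I → B9.Backgrounds)
    (Ck : ∀ i, B9.SiteKernel (geo i) (bg i)) (inΛ : ∀ i, (geo i).Site → Prop)
    (unitDist : ∀ i, (geo i).Site → (geo i).Site → ℝ) (a₀ δ₁ B₁ r m K : ℝ) : Prop :=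
  ∀ i : I, ∀ α₀ : ℝ, 0 < α₀ → (geo i).M * α₀ ≤ a₀ →
    ∀ U : (bg i).Cfg, (bg i).Reg335 c35 α₀ U → (bg i).Reg336 c35 α₀ U →
      Rep3185Dom (geo i) (bg i) (Ck i) (inΛ i) (unitDist i) U δ₁ B₁ r m K

/-- gen 11's uniform identity-form data are uniform domination-form data with K = 1. [folklore] -/
theorem hyp3185Dom_of_hyp3185 {I : Type} {c35 : ℝ} {geo : I → B9.Geometry} {bg : I → B9.Backgrounds}
    {Ck : ∀ i, B9.SiteKernel (geo i) (bg i)} {inΛ : ∀ i, (geo i).Site → Prop}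
    {unitDist : ∀ i, (geo i).Site → (geo i).Site → ℝ} {a₀ δ₁ B₁ r m : ℝ}
    (h : B9Thm315Decay.Hyp3185 c35 geo bg Ck inΛ unitDist a₀ δ₁ B₁ r m) :
    Hyp3185Dom c35 geo bg Ck inΛ unitDist a₀ δ₁ B₁ r m 1 :=
  fun i α₀ hα hMa U h35 h36 => rep3185Dom_of_rep3185 (h i α₀ hα hMa U h35 h36)

/-- **THE EDGE INTO THE TYPED THEOREM 3.15, DOMINATION FORM**: uniform data `Hyp3185Dom … a₀ δ₁ B₁ r m K` with
a₀, δ₁, B₁, m, K > 0 give r1's `B9.Thm315Printed` with δ₀ = δ₁, a₀, B₀ = K·B₁e^{2δ₁r}m².  The random-walk bound and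
the factorisation inside `Hyp3185Dom` are the OPEN inputs (G-B9-10).
[cite: Balaban1985BackgroundPropagators, Thm 3.15 (3.185)–(3.187) p.432] -/
theorem thm315Printed_of_3185Dom {I : Type} (c35 : ℝ) (geo : I → B9.Geometry) (bg : I → B9.Backgrounds)
    (Ck : ∀ i, B9.SiteKernel (geo i) (bg i)) (inΛ : ∀ i, (geo i).Site → Prop)
    (unitDist : ∀ i, (geo i).Site → (geo i).Site → ℝ) {a₀ δ₁ B₁ r m K : ℝ}
    (ha₀ : 0 < a₀) (hδ₁ : 0 < δ₁) (hB₁ : 0 < B₁) (hm : 0 < m) (hK : 0 < K)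
    (h : Hyp3185Dom c35 geo bg Ck inΛ unitDist a₀ δ₁ B₁ r m K) :
    B9.Thm315Printed c35 geo bg Ck inΛ unitDist := by
  refine ⟨δ₁, a₀, K * (B₁ * Real.exp (2 * δ₁ * r) * m * m), hδ₁, ha₀,
    mul_pos hK (mul_pos (mul_pos (mul_pos hB₁ (Real.exp_pos _)) hm) hm), ?_⟩
  intro i α₀ hα hMa U h35 h36 y y' hy hy'
  exact bound_of_rep3185Dom hB₁.le hδ₁.le hK.le (h i α₀ hα hMa U h35 h36) y y' hy hy'

end Dom

/-! ## §B  Bond charts for the scalar edges (repair of the b₋-chart over-determination) -/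

section ScalarCharts

variable {X Bond : Type} [Fintype X] [DecidableEq X] [Fintype Bond] [DecidableEq Bond]

omit [Fintype X] [DecidableEq X] [Fintype Bond] [DecidableEq Bond] in
/-- A chart of the BONDS into the sites along which |·| is the pseudo-distance of the initial points is a
pseudo-distance on bonds. [folklore] -/
theorem isPseudoDist_chart {Site : Type} (unitDist : Site → Site → ℝ) (src : Bond → X) (ρ : X → X → ℝ)
    (hρ : IsPseudoDist ρ) (χ : Bond → Site) (hχ : ∀ b b', unitDist (χ b) (χ b') = ρ (src b) (src b')) :
    IsPseudoDist (fun p q => unitDist (χ p) (χ q)) := by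
  have h : (fun p q => unitDist (χ p) (χ q)) = fun p q => ρ (src p) (src q) :=
    funext fun p => funext fun q => hχ p q
  rw [h]
  exact hρ.comp src

omit [Fintype X] [DecidableEq X] [Fintype Bond] [DecidableEq Bond] in
/-- KERNEL WITNESS OF THE OVER-DETERMINATION REPAIRED HERE: a factorisation hypothesis posed through the chart
b ↦ σ(b₋) (as in `B9Eq3169Mu.rep3185_of_eq3169`, `B9Eq3169Comb.BondModel.rep3185_of_comb`, `….rep3185_star`)
forces the bond-indexed matrix F = E S Eᵀ to take EQUAL values on all bond pairs with the same initial points —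
for d ≥ 2 (d bonds out of each site) a constraint on (E, S) that the print's bond-indexed C^{(k)}(Λ) does not impose.
[folklore] -/
theorem srcChart_forces_eq {Site : Type} (src : Bond → X) (σ : X → Site) (Kf : Site → Site → ℝ)
    (F : Matrix Bond Bond ℝ) (hfac : ∀ p q, Kf (σ (src p)) (σ (src q)) = F p q) {p p' q q' : Bond}
    (hp : src p = src p') (hq : src q = src q') : F p q = F p' q' := by
  rw [← hfac, ← hfac, hp, hq]

/-- **THE SCALAR EDGE WITH A BOND CHART** (repairing `B9Eq3169Mu.rep3185_of_eq3169`, whose chart is forced through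
b ↦ b₋): an axial frame in the scalar model, a pseudo-distance ρ on the sites with the three geometric hypotheses,
and a chart χ OF THE BONDS into r1's `B9.Geometry` with |χ b − χ b′| = ρ(b₋, b′₋) (injective charts exist: sites ⊇
bonds), covering `inΛ`; the factorisation (3.185) C^{(k)}(Λ)(χ p, χ q) = (E S Eᵀ)(p, q) — now ONE equation per bond
pair — and the random-walk bound stay hypotheses (G-B9-10).  Conclusion: `Rep3185 … U δ₁ B₁ (D + 1) (1 + 4ℓ)`.
[cite: Balaban1985BackgroundPropagators, (3.169) p.430 + (3.185)–(3.187) p.432] -/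
theorem rep3185_of_eq3169_chart {g : B9.Geometry} {Bg : B9.Backgrounds} {Ck : B9.SiteKernel g Bg}
    {inΛ : g.Site → Prop} {unitDist : g.Site → g.Site → ℝ} {U : Bg.Cfg} {δ₁ B₁ D ℓ : ℝ}
    (A : AxialFrame X Bond) (u : Bond → ℝ) (hu : ∀ b, |u b| = 1) (hℓ : ∀ x, ((A.Γ x).length : ℝ) ≤ ℓ)
    (ρ : X → X → ℝ) (hρ : IsPseudoDist ρ)
    (hdiam : ∀ x x', A.blk x' = A.blk x → ρ x x' ≤ D) (hbond : ∀ b, ρ (A.src b) (A.tgt b) ≤ 1)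
    (hin : ∀ x b', b' ∈ A.Γ x → A.blk (A.src b') = A.blk x)
    (χ : Bond → g.Site) (hχ : ∀ b b', unitDist (χ b) (χ b') = ρ (A.src b) (A.src b'))
    (hcov : ∀ y, inΛ y → ∃ b, χ b = y)
    (S : Matrix Bond Bond ℝ)
    (hfac : ∀ p q, Ck.ker U (χ p) (χ q) = (Emat A u * S * (Emat A u)ᵀ) p q)
    (hS : ∀ p q, |S p q| ≤ B₁ * Real.exp (-(δ₁ * unitDist (χ p) (χ q)))) :
    B9Thm315Decay.Rep3185 g Bg Ck inΛ unitDist U δ₁ B₁ (D + 1) (1 + 4 * ℓ) :=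
  ⟨Bond, inferInstance, χ, Emat A u, S, hcov, isPseudoDist_chart unitDist A.src ρ hρ χ hχ, hfac, hS,
    fun p q h => by rw [hχ]; exact Emat_range A u ρ hρ hdiam hbond hin p q h,
    sum_abs_Emat_le A u hu hℓ⟩

/-- gen 12's edge `B9Eq3169Mu.rep3185_of_eq3169` IS the special case χ = σ ∘ (b ↦ b₋) of the bond-chart edge
(kernel check of the relation between the two statements; an `example`, since the statement itself is gen 12's
landed theorem). [folklore] -/
example {g : B9.Geometry} {Bg : B9.Backgrounds} {Ck : B9.SiteKernel g Bg}
    {inΛ : g.Site → Prop} {unitDist : g.Site → g.Site → ℝ} {U : Bg.Cfg} {δ₁ B₁ D ℓ : ℝ}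
    (A : AxialFrame X Bond) (u : Bond → ℝ) (hu : ∀ b, |u b| = 1) (hℓ : ∀ x, ((A.Γ x).length : ℝ) ≤ ℓ)
    (σ : X → g.Site) (hρ : IsPseudoDist fun x x' => unitDist (σ x) (σ x'))
    (hdiam : ∀ x x', A.blk x' = A.blk x → unitDist (σ x) (σ x') ≤ D)
    (hbond : ∀ b, unitDist (σ (A.src b)) (σ (A.tgt b)) ≤ 1)
    (hin : ∀ x b', b' ∈ A.Γ x → A.blk (A.src b') = A.blk x)
    (hcov : ∀ y, inΛ y → ∃ b : Bond, σ (A.src b) = y)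
    (S : Matrix Bond Bond ℝ)
    (hfac : ∀ p q, Ck.ker U (σ (A.src p)) (σ (A.src q)) = (Emat A u * S * (Emat A u)ᵀ) p q)
    (hS : ∀ p q, |S p q| ≤ B₁ * Real.exp (-(δ₁ * unitDist (σ (A.src p)) (σ (A.src q))))) :
    B9Thm315Decay.Rep3185 g Bg Ck inΛ unitDist U δ₁ B₁ (D + 1) (1 + 4 * ℓ) :=
  rep3185_of_eq3169_chart A u hu hℓ (fun x x' => unitDist (σ x) (σ x')) hρ hdiam hbond hin
    (fun b => σ (A.src b)) (fun _ _ => rfl) hcov S hfac hS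

/-- The scalar edge with a bond chart in DOMINATION form (`Rep3185Dom … (D + 1) (1 + 4ℓ) K`).
[cite: Balaban1985BackgroundPropagators, (3.169) p.430 + (3.185)–(3.187) p.432] -/
theorem rep3185Dom_of_eq3169_chart {g : B9.Geometry} {Bg : B9.Backgrounds} {Ck : B9.SiteKernel g Bg}
    {inΛ : g.Site → Prop} {unitDist : g.Site → g.Site → ℝ} {U : Bg.Cfg} {δ₁ B₁ D ℓ K : ℝ}
    (A : AxialFrame X Bond) (u : Bond → ℝ) (hu : ∀ b, |u b| = 1) (hℓ : ∀ x, ((A.Γ x).length : ℝ) ≤ ℓ)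
    (ρ : X → X → ℝ) (hρ : IsPseudoDist ρ)
    (hdiam : ∀ x x', A.blk x' = A.blk x → ρ x x' ≤ D) (hbond : ∀ b, ρ (A.src b) (A.tgt b) ≤ 1)
    (hin : ∀ x b', b' ∈ A.Γ x → A.blk (A.src b') = A.blk x)
    (χ : Bond → g.Site) (hχ : ∀ b b', unitDist (χ b) (χ b') = ρ (A.src b) (A.src b'))
    (S : Matrix Bond Bond ℝ)
    (hS : ∀ p q, |S p q| ≤ B₁ * Real.exp (-(δ₁ * unitDist (χ p) (χ q))))
    (hdom : ∀ y y', inΛ y → inΛ y' →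
      ∃ p q, χ p = y ∧ χ q = y' ∧ |Ck.ker U y y'| ≤ K * |(Emat A u * S * (Emat A u)ᵀ) p q|) :
    Rep3185Dom g Bg Ck inΛ unitDist U δ₁ B₁ (D + 1) (1 + 4 * ℓ) K :=
  ⟨Bond, inferInstance, χ, Emat A u, S, isPseudoDist_chart unitDist A.src ρ hρ χ hχ, hS,
    fun p q h => by rw [hχ]; exact Emat_range A u ρ hρ hdiam hbond hin p q h,
    sum_abs_Emat_le A u hu hℓ, hdom⟩

/-- **THE COMB EDGE WITH A BOND CHART** (repairing `B9Eq3169Comb.BondModel.rep3185_of_comb`): for Λ ⊂ ℤ^d a union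
of L-blocks and any bond convention M, a chart χ of the bonds of M with |χ b − χ b′| = the sup-distance of the
initial points, the factorisation (3.185) per bond pair and the random-walk bound give `Rep3185 … U δ₁ B₁ L
(1 + 4d(L − 1))` for `inΛ` = THE IMAGE OF χ — coverage is automatic, for every convention and every d.
[cite: Balaban1985BackgroundPropagators, (3.185) + (3.187) p.432] -/
theorem comb_rep3185_of_chart {d L : ℕ} (hL : 0 < L) {Λ : Finset (Fin d → ℤ)} (hΛ : BlockClosed L Λ)
    (M : BondModel L Λ) {g : B9.Geometry} {Bg : B9.Backgrounds} {Ck : B9.SiteKernel g Bg}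
    {unitDist : g.Site → g.Site → ℝ} {U : Bg.Cfg} {δ₁ B₁ : ℝ}
    (u : ↥M.bd → ℝ) (hu : ∀ b, |u b| = 1) (χ : ↥M.bd → g.Site)
    (hχ : ∀ b b', unitDist (χ b) (χ b') = dist b.1.1 b'.1.1)
    (S : Matrix ↥M.bd ↥M.bd ℝ)
    (hfac : ∀ p q, Ck.ker U (χ p) (χ q) = (Emat (M.frame hL hΛ) u * S * (Emat (M.frame hL hΛ) u)ᵀ) p q)
    (hS : ∀ p q, |S p q| ≤ B₁ * Real.exp (-(δ₁ * unitDist (χ p) (χ q)))) :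
    B9Thm315Decay.Rep3185 g Bg Ck (fun y => ∃ b, χ b = y) unitDist U δ₁ B₁ L (1 + 4 * (d * ((L : ℝ) - 1))) := by
  have hχ' : ∀ b b', unitDist (χ b) (χ b') = dist ((M.frame hL hΛ).src b).1 ((M.frame hL hΛ).src b').1 := by
    intro b b'; rw [hχ]; rfl
  have h := rep3185_of_eq3169_chart (inΛ := fun y => ∃ b, χ b = y) (M.frame hL hΛ) u hu
    (M.length_frame_Γ_le hL hΛ) (fun x x' : ↥M.sites => dist x.1 x'.1) M.isPseudoDist_dist
    (M.frame_hdiam hL hΛ) (M.frame_hbond hL hΛ) (M.frame_hin hL hΛ) χ hχ' (fun y hy => hy) S hfac hS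
  have h2 : ((L : ℝ) - 1) + 1 = L := by ring
  rw [h2] at h
  exact h

/-- … hence (3.187) for every pair of bonds of M: |C^{(k)}(Λ; χ b, χ b′)| ≤
B₁e^{2δ₁L}(1 + 4d(L − 1))²·e^{−δ₁|b₋ − b′₋|}. [cite: Balaban1985BackgroundPropagators, (3.187) p.432] -/
theorem comb_bound_3187_of_chart {d L : ℕ} (hL : 0 < L) {Λ : Finset (Fin d → ℤ)} (hΛ : BlockClosed L Λ)
    (M : BondModel L Λ) {g : B9.Geometry} {Bg : B9.Backgrounds} {Ck : B9.SiteKernel g Bg}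
    {unitDist : g.Site → g.Site → ℝ} {U : Bg.Cfg} {δ₁ B₁ : ℝ} (hB₁ : 0 ≤ B₁) (hδ₁ : 0 ≤ δ₁)
    (u : ↥M.bd → ℝ) (hu : ∀ b, |u b| = 1) (χ : ↥M.bd → g.Site)
    (hχ : ∀ b b', unitDist (χ b) (χ b') = dist b.1.1 b'.1.1)
    (S : Matrix ↥M.bd ↥M.bd ℝ)
    (hfac : ∀ p q, Ck.ker U (χ p) (χ q) = (Emat (M.frame hL hΛ) u * S * (Emat (M.frame hL hΛ) u)ᵀ) p q)
    (hS : ∀ p q, |S p q| ≤ B₁ * Real.exp (-(δ₁ * unitDist (χ p) (χ q)))) (b b' : ↥M.bd) :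
    |Ck.ker U (χ b) (χ b')| ≤ B₁ * Real.exp (2 * δ₁ * L) * (1 + 4 * (d * ((L : ℝ) - 1))) *
      (1 + 4 * (d * ((L : ℝ) - 1))) * Real.exp (-(δ₁ * dist b.1.1 b'.1.1)) := by
  rw [← hχ]
  exact B9Thm315Decay.bound_of_rep3185 hB₁ hδ₁ (comb_rep3185_of_chart hL hΛ M u hu χ hχ S hfac hS)
    (χ b) (χ b') ⟨b, rfl⟩ ⟨b', rfl⟩

end ScalarCharts

/-! ## §C  The non-abelian (vector) model: isometric transports on a real normed space 𝔤 -/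

section Local

variable {X Bond 𝔤 : Type} [Fintype X] [DecidableEq X] [AddCommGroup 𝔤] [Module ℝ 𝔤]

/-- RANGE, combinatorial form, for ANY 𝔤 and ANY linear transports: a bond function vanishing at b and on the axial
bonds of the blocks of b₋ and b₊ has E(B)(b) = 0 (locality `dress_congr` + linearity).
[cite: Balaban1985BackgroundPropagators, (3.169) p.430 + (3.185) p.432] -/
theorem dress_eq_zero_of_vanish (A : AxialFrame X Bond) (R : Bond → 𝔤 ≃ₗ[ℝ] 𝔤) {B : Bond → 𝔤} {b : Bond}
    (h0 : B b = 0) (hs : ∀ b', A.InAx (A.src b) b' → B b' = 0) (ht : ∀ b', A.InAx (A.tgt b) b' → B b' = 0) :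
    A.dress R B b = 0 := by
  have hz : A.dress R (0 : Bond → 𝔤) = 0 := by
    rw [← AxialFrame.dressLin_apply]
    exact map_zero _
  rw [A.dress_congr R (B₂ := 0) h0 hs ht, hz]
  rfl

end Local

section Normed

variable {X Bond 𝔤 : Type} [NormedAddCommGroup 𝔤] [NormedSpace ℝ 𝔤]

/-- ISOMETRIC TRANSPORTS (the adjoint action R(U)X = UXU⁻¹ of a unitary U preserves the Hilbert–Schmidt norm
|X|² = tr X*X of p. 390; typed: any linear isometries of a real normed space 𝔤), as the linear equivalences of the
(3.169) calculus of `B9Eq3169Mu`. [cite: Balaban1985BackgroundPropagators, p.390] -/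
def Ri (T : Bond → 𝔤 ≃ₗᵢ[ℝ] 𝔤) : Bond → 𝔤 ≃ₗ[ℝ] 𝔤 := fun b => (T b).toLinearEquiv

/-- `Ri T b` acts as `T b`. [folklore] -/
@[simp] theorem Ri_apply (T : Bond → 𝔤 ≃ₗᵢ[ℝ] 𝔤) (b : Bond) (v : 𝔤) : Ri T b v = T b v := rfl

/-- R(V(Γ)) is an isometry. [folklore] -/
theorem norm_hol (T : Bond → 𝔤 ≃ₗᵢ[ℝ] 𝔤) : ∀ (Γ : List Bond) (v : 𝔤), ‖hol (Ri T) Γ v‖ = ‖v‖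
  | [], _ => rfl
  | b :: Γ, v => by rw [hol_cons_apply, Ri_apply, LinearIsometryEquiv.norm_map, norm_hol T Γ v]

/-- R(V(Γ))⁻¹ is an isometry. [folklore] -/
theorem norm_hol_symm (T : Bond → 𝔤 ≃ₗᵢ[ℝ] 𝔤) (Γ : List Bond) (v : 𝔤) : ‖(hol (Ri T) Γ).symm v‖ = ‖v‖ := by
  conv_rhs => rw [← (hol (Ri T) Γ).apply_symm_apply v]
  rw [norm_hol]

/-- ‖(R_y(V)B)(Γ)‖ ≤ |Γ|·sup_Γ‖B‖ for isometric transports. [folklore] -/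
theorem norm_trSum_le (T : Bond → 𝔤 ≃ₗᵢ[ℝ] 𝔤) (B : Bond → 𝔤) {β : ℝ} :
    ∀ Γ : List Bond, (∀ b ∈ Γ, ‖B b‖ ≤ β) → ‖trSum (Ri T) B Γ‖ ≤ Γ.length * β
  | [], _ => by simp
  | b :: Γ, h => by
      rw [trSum_cons, List.length_cons, Nat.cast_succ, add_mul, one_mul]
      refine (norm_add_le _ _).trans ?_
      rw [Ri_apply, LinearIsometryEquiv.norm_map, add_comm]
      exact add_le_add (norm_trSum_le T B Γ fun b' hb' => h b' (by simp [hb'])) (h b (by simp))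

variable [Fintype X] [DecidableEq X] (A : AxialFrame X Bond) (T : Bond → 𝔤 ≃ₗᵢ[ℝ] 𝔤)

/-- ‖Q′(R_y(V)B)(Γ_{y,·})‖ ≤ ℓ·sup‖B‖ (a convex combination of transported sums along contours of length ≤ ℓ).
[folklore] -/
theorem norm_bavg_le (B : Bond → 𝔤) {β ℓ : ℝ} (hB : ∀ b, ‖B b‖ ≤ β) (hβ : 0 ≤ β)
    (hℓ : ∀ x, ((A.Γ x).length : ℝ) ≤ ℓ) (x : X) : ‖A.bavg (Ri T) B x‖ ≤ ℓ * β := by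
  unfold AxialFrame.bavg
  calc ‖∑ x' ∈ A.block x, A.w x' • trSum (Ri T) B (A.Γ x')‖
      ≤ ∑ x' ∈ A.block x, ‖A.w x' • trSum (Ri T) B (A.Γ x')‖ := norm_sum_le _ _
    _ ≤ ∑ x' ∈ A.block x, A.w x' * (ℓ * β) := Finset.sum_le_sum fun x' _ => by
        rw [norm_smul, Real.norm_of_nonneg (A.w_nonneg x')]
        exact mul_le_mul_of_nonneg_left
          ((norm_trSum_le T B (A.Γ x') fun b _ => hB b).trans (mul_le_mul_of_nonneg_right (hℓ x') hβ))
          (A.w_nonneg x')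
    _ = ℓ * β := by rw [← Finset.sum_mul, A.sum_w, one_mul]

/-- **‖μ(B)(x)‖ ≤ 2ℓ·sup‖B‖** for isometric transports (μ(x) = an isometry applied to the difference of a block
mean of transported sums and one transported sum). [cite: Balaban1985BackgroundPropagators, (3.169) p.430] -/
theorem norm_mu_le (B : Bond → 𝔤) {β ℓ : ℝ} (hB : ∀ b, ‖B b‖ ≤ β) (hβ : 0 ≤ β)
    (hℓ : ∀ x, ((A.Γ x).length : ℝ) ≤ ℓ) (x : X) : ‖A.mu (Ri T) B x‖ ≤ 2 * ℓ * β := by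
  rw [AxialFrame.mu, norm_hol_symm]
  refine (norm_sub_le _ _).trans ?_
  have h1 := norm_bavg_le A T B hB hβ hℓ x
  have h2 : ‖trSum (Ri T) B (A.Γ x)‖ ≤ ℓ * β :=
    (norm_trSum_le T B (A.Γ x) fun b _ => hB b).trans (mul_le_mul_of_nonneg_right (hℓ x) hβ)
  linarith

/-- **OPERATOR-NORM ROW SUMS: ‖E(B)(b)‖ ≤ (1 + 4ℓ)·sup‖B‖** for isometric transports — the non-abelian form of
`B9Eq3169Mu.sum_abs_Emat_le` (E(B)(b) = B(b) + R(V(b))μ(b₊) − μ(b₋)).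
[cite: Balaban1985BackgroundPropagators, (3.169) p.430 + (3.185) p.432] -/
theorem norm_dress_le (B : Bond → 𝔤) {β ℓ : ℝ} (hB : ∀ b, ‖B b‖ ≤ β) (hβ : 0 ≤ β)
    (hℓ : ∀ x, ((A.Γ x).length : ℝ) ≤ ℓ) (b : Bond) : ‖A.dress (Ri T) B b‖ ≤ (1 + 4 * ℓ) * β := by
  rw [AxialFrame.dress, Pi.add_apply, cod_apply, Ri_apply]
  refine (norm_add_le _ _).trans ?_
  refine (add_le_add (hB b) ((norm_sub_le _ _).trans
    (add_le_add (le_of_eq (LinearIsometryEquiv.norm_map _ _)) le_rfl))).trans ?_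
  have h1 := norm_mu_le A T B hB hβ hℓ (A.tgt b)
  have h2 := norm_mu_le A T B hB hβ hℓ (A.src b)
  linarith

end Normed

section Inner

variable {X Bond 𝔤 : Type} [NormedAddCommGroup 𝔤] [InnerProductSpace ℝ 𝔤]

/-- THE DICTIONARY FROM THE gen-12 VOCABULARY: transports `R : Bond → 𝔤 ≃ₗ[ℝ] 𝔤` preserving an inner product
of 𝔤 (for R(U)X = UXU⁻¹, U unitary, and the Hilbert–Schmidt form Re tr X*Y of p. 390: ⟨UXU⁻¹, UYU⁻¹⟩ = ⟨X, Y⟩) ARE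
isometric transports (`LinearEquiv.isometryOfInner`). [cite: Balaban1985BackgroundPropagators, p.390] -/
noncomputable def RiOfInner (R : Bond → 𝔤 ≃ₗ[ℝ] 𝔤) (h : ∀ b x y, inner ℝ (R b x) (R b y) = inner ℝ x y) :
    Bond → 𝔤 ≃ₗᵢ[ℝ] 𝔤 :=
  fun b => (R b).isometryOfInner (h b)

/-- … and their linear equivalences are the given R (so every statement below about `Ri T` is a statement about
inner-product preserving R). [folklore] -/
@[simp] theorem Ri_RiOfInner (R : Bond → 𝔤 ≃ₗ[ℝ] 𝔤) (h : ∀ b x y, inner ℝ (R b x) (R b y) = inner ℝ x y) :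
    Ri (RiOfInner R h) = R := rfl

variable [Fintype X] [DecidableEq X] (A : AxialFrame X Bond)

/-- ‖E(B)(b)‖ ≤ (1 + 4ℓ)·sup‖B‖ for inner-product preserving transports, in the gen-12 vocabulary.
[cite: Balaban1985BackgroundPropagators, (3.169) p.430 + (3.185) p.432] -/
theorem norm_dress_le_of_inner (R : Bond → 𝔤 ≃ₗ[ℝ] 𝔤) (h : ∀ b x y, inner ℝ (R b x) (R b y) = inner ℝ x y)
    (B : Bond → 𝔤) {β ℓ : ℝ} (hB : ∀ b, ‖B b‖ ≤ β) (hβ : 0 ≤ β) (hℓ : ∀ x, ((A.Γ x).length : ℝ) ≤ ℓ)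
    (b : Bond) : ‖A.dress R B b‖ ≤ (1 + 4 * ℓ) * β := by
  have h1 := norm_dress_le A (RiOfInner R h) B hB hβ hℓ b
  rwa [Ri_RiOfInner] at h1

/-- ‖μ(B)(x)‖ ≤ 2ℓ·sup‖B‖ for inner-product preserving transports, in the gen-12 vocabulary.
[cite: Balaban1985BackgroundPropagators, (3.169) p.430] -/
theorem norm_mu_le_of_inner (R : Bond → 𝔤 ≃ₗ[ℝ] 𝔤) (h : ∀ b x y, inner ℝ (R b x) (R b y) = inner ℝ x y)
    (B : Bond → 𝔤) {β ℓ : ℝ} (hB : ∀ b, ‖B b‖ ≤ β) (hβ : 0 ≤ β) (hℓ : ∀ x, ((A.Γ x).length : ℝ) ≤ ℓ)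
    (x : X) : ‖A.mu R B x‖ ≤ 2 * ℓ * β := by
  have h1 := norm_mu_le A (RiOfInner R h) B hB hβ hℓ x
  rwa [Ri_RiOfInner] at h1

end Inner

/-! ### 𝔤 = ℝ^n: the scalar-entry matrix of E over bonds × colours -/

section Euclidean

variable {X Bond : Type} [Fintype X] [DecidableEq X] [Fintype Bond] [DecidableEq Bond] {n : ℕ}

/-- A vector with coordinates of modulus ≤ 1 has Euclidean norm ≤ √n. [folklore] -/
theorem norm_le_sqrt_of_abs_le_one (v : EuclideanSpace ℝ (Fin n)) (h : ∀ i, |v i| ≤ 1) : ‖v‖ ≤ Real.sqrt n := by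
  rw [EuclideanSpace.norm_eq]
  refine Real.sqrt_le_sqrt ?_
  calc ∑ i, ‖v i‖ ^ 2 ≤ ∑ _i : Fin n, (1 : ℝ) := Finset.sum_le_sum fun i _ => by
          rw [Real.norm_eq_abs]
          have h1 := h i
          have h0 : 0 ≤ |v i| := abs_nonneg _
          nlinarith
    _ = n := by simp

/-- The bond function e_j·𝟙_{b′}: the unit colour vector e_j at the bond b′, zero elsewhere. [folklore] -/
noncomputable def unitB (q : Bond × Fin n) : Bond → EuclideanSpace ℝ (Fin n) :=
  fun b => if b = q.1 then EuclideanSpace.single q.2 (1 : ℝ) else 0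

omit [Fintype Bond] in
/-- Coordinates of `unitB`. [folklore] -/
theorem unitB_apply (q : Bond × Fin n) (b : Bond) (i : Fin n) :
    unitB q b i = if b = q.1 ∧ i = q.2 then 1 else 0 := by
  unfold unitB
  by_cases hb : b = q.1
  · rw [if_pos hb]
    by_cases hi : i = q.2
    · rw [if_pos ⟨hb, hi⟩, hi]
      simp
    · rw [if_neg (fun h => hi h.2)]
      simp [hi]
  · rw [if_neg hb, if_neg (fun h => hb h.1)]
    rfl

/-- Every bond function is the combination Σ_{(b′,j)} B(b′)_j · e_j𝟙_{b′}. [folklore] -/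
theorem unitB_decomp (B : Bond → EuclideanSpace ℝ (Fin n)) :
    B = ∑ q : Bond × Fin n, (B q.1 q.2) • unitB q := by
  funext b
  ext i
  rw [Finset.sum_apply, WithLp.ofLp_sum, Finset.sum_apply]
  simp only [WithLp.ofLp_smul, Pi.smul_apply, smul_eq_mul]
  have h : ∀ q : Bond × Fin n, B q.1 q.2 * (unitB q b : EuclideanSpace ℝ (Fin n)) i =
      if q = (b, i) then B b i else 0 := by
    intro q
    rw [unitB_apply]
    by_cases hq : q = (b, i)
    · rw [if_pos hq, hq, if_pos ⟨rfl, rfl⟩, mul_one]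
    · rw [if_neg hq, if_neg, mul_zero]
      rintro ⟨h1, h2⟩
      exact hq (Prod.ext h1.symm h2.symm)
  rw [Finset.sum_congr rfl fun q _ => h q, Finset.sum_ite_eq' Finset.univ (b, i), if_pos (Finset.mem_univ _)]

variable (A : AxialFrame X Bond) (T : Bond → EuclideanSpace ℝ (Fin n) ≃ₗᵢ[ℝ] EuclideanSpace ℝ (Fin n))

/-- THE SCALAR-ENTRY MATRIX OF E = I + D̄μ(·) OVER P = bonds × colours: E((b,i),(b′,j)) = (E(e_j𝟙_{b′})(b))_i.
[cite: Balaban1985BackgroundPropagators, (3.169) p.430 + (3.185) p.432] -/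
noncomputable def EmatN : Matrix (Bond × Fin n) (Bond × Fin n) ℝ :=
  fun p q => A.dress (Ri T) (unitB q) p.1 p.2

/-- E(B)(b)_i = Σ_{(b′,j)} E((b,i),(b′,j))·B(b′)_j — E(B) = EmatN·B in coordinates.
[cite: Balaban1985BackgroundPropagators, (3.185) p.432] -/
theorem dress_coord (B : Bond → EuclideanSpace ℝ (Fin n)) (b : Bond) (i : Fin n) :
    A.dress (Ri T) B b i = ∑ q : Bond × Fin n, EmatN A T (b, i) q * B q.1 q.2 := by
  conv_lhs => rw [unitB_decomp B, ← AxialFrame.dressLin_apply, map_sum]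
  rw [Finset.sum_apply, WithLp.ofLp_sum, Finset.sum_apply]
  refine Finset.sum_congr rfl fun q _ => ?_
  rw [map_smul, AxialFrame.dressLin_apply, Pi.smul_apply, WithLp.ofLp_smul, Pi.smul_apply, smul_eq_mul,
    mul_comm]
  rfl

omit [Fintype Bond] in
/-- **RANGE, combinatorial form**: E((b,i),(b′,j)) ≠ 0 ⇒ b′ = b, or b′ is an axial bond of the block of b₊ or of
b₋. [cite: Balaban1985BackgroundPropagators, (3.169) p.430] -/
theorem EmatN_ne_zero {p q : Bond × Fin n} (h : EmatN A T p q ≠ 0) :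
    q.1 = p.1 ∨ A.InAx (A.tgt p.1) q.1 ∨ A.InAx (A.src p.1) q.1 := by
  by_contra hc
  simp only [not_or] at hc
  apply h
  have hz : A.dress (Ri T) (unitB q) p.1 = 0 := by
    refine dress_eq_zero_of_vanish A (Ri T) ?_ ?_ ?_
    · unfold unitB; rw [if_neg (fun e => hc.1 e.symm)]
    · intro b' hb'; unfold unitB; rw [if_neg]; rintro rfl; exact hc.2.2 hb'
    · intro b' hb'; unfold unitB; rw [if_neg]; rintro rfl; exact hc.2.1 hb'
  show A.dress (Ri T) (unitB q) p.1 p.2 = 0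
  rw [hz]
  rfl

omit [Fintype Bond] in
/-- **RANGE, metric form**: with blocks of ρ-diameter ≤ D, bonds of ρ-length ≤ 1 and axial bonds sourced in their
block, E((b,i),(b′,j)) ≠ 0 ⇒ ρ(b₋, b′₋) ≤ D + 1 — the SAME range as in the scalar model.
[cite: Balaban1985BackgroundPropagators, (3.169) p.430 + (3.187) p.432] -/
theorem EmatN_range (ρ : X → X → ℝ) (hρ : IsPseudoDist ρ) {D : ℝ}
    (hdiam : ∀ x x', A.blk x' = A.blk x → ρ x x' ≤ D) (hbond : ∀ b, ρ (A.src b) (A.tgt b) ≤ 1)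
    (hin : ∀ x b', b' ∈ A.Γ x → A.blk (A.src b') = A.blk x) :
    ∀ p q, EmatN A T p q ≠ 0 → ρ (A.src p.1) (A.src q.1) ≤ D + 1 := by
  intro p q h
  have hD : 0 ≤ D := le_trans (le_of_eq (hρ.zero _).symm) (hdiam (A.src p.1) (A.src p.1) rfl)
  have hAx : ∀ x, A.InAx x q.1 → ρ x (A.src q.1) ≤ D := by
    rintro x ⟨x', hx', hb'⟩
    exact hdiam x (A.src q.1) (by rw [hin x' q.1 hb', hx'])
  rcases EmatN_ne_zero A T h with h1 | h2 | h3
  · rw [h1, hρ.zero]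
    linarith
  · calc ρ (A.src p.1) (A.src q.1) ≤ ρ (A.src p.1) (A.tgt p.1) + ρ (A.tgt p.1) (A.src q.1) := hρ.triangle _ _ _
      _ ≤ 1 + D := add_le_add (hbond p.1) (hAx _ h2)
      _ = D + 1 := add_comm _ _
  · linarith [hAx _ h3]

/-- Row ℓ¹-mass by duality: if |Σ_q E(p,q)s(q)| ≤ m for every sign pattern |s| ≤ 1, then Σ_q|E(p,q)| ≤ m. [folklore] -/
theorem sum_abs_le_of_dual {P : Type} [Fintype P] (E : Matrix P P ℝ) (p : P) {m : ℝ}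
    (h : ∀ s : P → ℝ, (∀ q, |s q| ≤ 1) → |∑ q, E p q * s q| ≤ m) : ∑ q, |E p q| ≤ m := by
  let s : P → ℝ := fun q => if 0 ≤ E p q then 1 else -1
  have hs : ∀ q, |s q| ≤ 1 := fun q => by
    simp only [s]
    split_ifs <;> simp
  have he : ∀ q, E p q * s q = |E p q| := fun q => by
    simp only [s]
    split_ifs with hq
    · rw [mul_one, abs_of_nonneg hq]
    · rw [mul_neg, mul_one, abs_of_neg (lt_of_not_ge hq)]
  have h1 := h s hs
  simp_rw [he] at h1
  exact le_trans (le_abs_self _) h1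

/-- **SCALAR-ENTRY ROW SUMS ≤ (1 + 4ℓ)√n**: Σ_{(b′,j)}|E((b,i),(b′,j))| ≤ (1 + 4ℓ)·√n for isometric transports on
ℝ^n and contours of length ≤ ℓ (duality with the sign-pattern bond functions, of Euclidean size ≤ √n, and
`norm_dress_le`). [cite: Balaban1985BackgroundPropagators, (3.169) p.430 + (3.187) p.432] -/
theorem sum_abs_EmatN_le {ℓ : ℝ} (hℓ : ∀ x, ((A.Γ x).length : ℝ) ≤ ℓ) (p : Bond × Fin n) :
    ∑ q, |EmatN A T p q| ≤ (1 + 4 * ℓ) * Real.sqrt n := by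
  refine sum_abs_le_of_dual (EmatN A T) p fun s hs => ?_
  let B : Bond → EuclideanSpace ℝ (Fin n) := fun b' => WithLp.toLp 2 fun j => s (b', j)
  have hB : ∀ b', ‖B b'‖ ≤ Real.sqrt n := fun b' =>
    norm_le_sqrt_of_abs_le_one (B b') fun j => hs (b', j)
  have hc : ∑ q, EmatN A T p q * s q = A.dress (Ri T) B p.1 p.2 := by
    rw [dress_coord]
  rw [hc, ← Real.norm_eq_abs]
  exact (PiLp.norm_apply_le _ _).trans (norm_dress_le A T B hB (Real.sqrt_nonneg _) hℓ p.1)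

/-- **THE NON-ABELIAN EDGE** (domination form, bond-colour chart): an axial frame with isometric transports on ℝ^n,
contours of length ≤ ℓ, the three geometric hypotheses for a pseudo-distance ρ on the sites, a chart χ of the BONDS
with |χ b − χ b′| = ρ(b₋, b′₋); index set P = bonds × colours charted by (b, i) ↦ χ b; HYPOTHESES (G-B9-10 OPEN, as
in gen 11–13): the random-walk bound of S = QG̃₂Q* as a P × P matrix, and the factorisation (3.185) in the
block-dominated reading |C^{(k)}(Λ; y, y′)| ≤ K·|(E S Eᵀ)((b,i),(b′,j))| for some colours over some bonds charted to
y, y′.  Conclusion: `Rep3185Dom … U δ₁ B₁ (D + 1) ((1 + 4ℓ)√n) K`.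
[cite: Balaban1985BackgroundPropagators, (3.169) p.430 + (3.185)–(3.187) p.432] -/
theorem rep3185Dom_of_eq3169N {g : B9.Geometry} {Bg : B9.Backgrounds} {Ck : B9.SiteKernel g Bg}
    {inΛ : g.Site → Prop} {unitDist : g.Site → g.Site → ℝ} {U : Bg.Cfg} {δ₁ B₁ D ℓ K : ℝ}
    (hℓ : ∀ x, ((A.Γ x).length : ℝ) ≤ ℓ) (ρ : X → X → ℝ) (hρ : IsPseudoDist ρ)
    (hdiam : ∀ x x', A.blk x' = A.blk x → ρ x x' ≤ D) (hbond : ∀ b, ρ (A.src b) (A.tgt b) ≤ 1)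
    (hin : ∀ x b', b' ∈ A.Γ x → A.blk (A.src b') = A.blk x)
    (χ : Bond → g.Site) (hχ : ∀ b b', unitDist (χ b) (χ b') = ρ (A.src b) (A.src b'))
    (S : Matrix (Bond × Fin n) (Bond × Fin n) ℝ)
    (hS : ∀ p q, |S p q| ≤ B₁ * Real.exp (-(δ₁ * unitDist (χ p.1) (χ q.1))))
    (hdom : ∀ y y', inΛ y → inΛ y' → ∃ p q : Bond × Fin n, χ p.1 = y ∧ χ q.1 = y' ∧
      |Ck.ker U y y'| ≤ K * |(EmatN A T * S * (EmatN A T)ᵀ) p q|) :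
    Rep3185Dom g Bg Ck inΛ unitDist U δ₁ B₁ (D + 1) ((1 + 4 * ℓ) * Real.sqrt n) K :=
  ⟨Bond × Fin n, inferInstance, fun p => χ p.1, EmatN A T, S,
    isPseudoDist_chart unitDist (fun p : Bond × Fin n => A.src p.1) ρ hρ (fun p => χ p.1) (fun p q => hχ p.1 q.1),
    hS, fun p q h => by rw [hχ]; exact EmatN_range A T ρ hρ hdiam hbond hin p q h,
    sum_abs_EmatN_le A T hℓ, hdom⟩

end Euclidean

/-! ## §D  The comb instance: r = L, m = (1 + 4d(L − 1))√n -/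

section Comb

variable {d L : ℕ} {n : ℕ}

/-- RANGE ≤ L in the vector model on a union of L-blocks of ℤ^d (sup-distance of initial points).
[cite: Balaban1985BackgroundPropagators, p.432 ("depending on d and L only")] -/
theorem comb_EmatN_range (hL : 0 < L) {Λ : Finset (Fin d → ℤ)} (hΛ : BlockClosed L Λ) (M : BondModel L Λ)
    (T : ↥M.bd → EuclideanSpace ℝ (Fin n) ≃ₗᵢ[ℝ] EuclideanSpace ℝ (Fin n))
    (p q : ↥M.bd × Fin n) (h : EmatN (M.frame hL hΛ) T p q ≠ 0) : dist p.1.1.1 q.1.1.1 ≤ L := by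
  have h1 := EmatN_range (M.frame hL hΛ) T (fun x x' : ↥M.sites => dist x.1 x'.1) M.isPseudoDist_dist
    (M.frame_hdiam hL hΛ) (M.frame_hbond hL hΛ) (M.frame_hin hL hΛ) p q h
  have h2 : ((L : ℝ) - 1) + 1 = L := by ring
  rw [h2] at h1
  exact h1

/-- ROW SUMS ≤ (1 + 4d(L − 1))√n in the vector model on a union of L-blocks of ℤ^d.
[cite: Balaban1985BackgroundPropagators, p.432 ("depending on d and L only")] -/
theorem comb_sum_abs_EmatN_le (hL : 0 < L) {Λ : Finset (Fin d → ℤ)} (hΛ : BlockClosed L Λ) (M : BondModel L Λ)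
    (T : ↥M.bd → EuclideanSpace ℝ (Fin n) ≃ₗᵢ[ℝ] EuclideanSpace ℝ (Fin n)) (p : ↥M.bd × Fin n) :
    ∑ q, |EmatN (M.frame hL hΛ) T p q| ≤ (1 + 4 * (d * ((L : ℝ) - 1))) * Real.sqrt n :=
  sum_abs_EmatN_le (M.frame hL hΛ) T (M.length_frame_Γ_le hL hΛ) p

/-- **THE NON-ABELIAN COMB EDGE**: for Λ ⊂ ℤ^d a union of L-blocks, any bond convention M, isometric transports on
ℝ^n, a bond chart χ with |χ b − χ b′| = |b₋ − b′₋|_∞, the random-walk bound and the block-dominated factorisation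
(3.185) as hypotheses: `Rep3185Dom … U δ₁ B₁ L ((1 + 4d(L − 1))√n) K` for `inΛ` = the image of χ — range and row
constants depending on d, L (and n = dim 𝔤) only. [cite: Balaban1985BackgroundPropagators, (3.185) + (3.187) p.432] -/
theorem comb_rep3185Dom_N (hL : 0 < L) {Λ : Finset (Fin d → ℤ)} (hΛ : BlockClosed L Λ) (M : BondModel L Λ)
    (T : ↥M.bd → EuclideanSpace ℝ (Fin n) ≃ₗᵢ[ℝ] EuclideanSpace ℝ (Fin n))
    {g : B9.Geometry} {Bg : B9.Backgrounds} {Ck : B9.SiteKernel g Bg} {unitDist : g.Site → g.Site → ℝ}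
    {U : Bg.Cfg} {δ₁ B₁ K : ℝ} (χ : ↥M.bd → g.Site) (hχ : ∀ b b', unitDist (χ b) (χ b') = dist b.1.1 b'.1.1)
    (S : Matrix (↥M.bd × Fin n) (↥M.bd × Fin n) ℝ)
    (hS : ∀ p q, |S p q| ≤ B₁ * Real.exp (-(δ₁ * unitDist (χ p.1) (χ q.1))))
    (hdom : ∀ y y', (∃ b, χ b = y) → (∃ b, χ b = y') → ∃ p q : ↥M.bd × Fin n, χ p.1 = y ∧ χ q.1 = y' ∧
      |Ck.ker U y y'| ≤ K * |(EmatN (M.frame hL hΛ) T * S * (EmatN (M.frame hL hΛ) T)ᵀ) p q|) :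
    Rep3185Dom g Bg Ck (fun y => ∃ b, χ b = y) unitDist U δ₁ B₁ L ((1 + 4 * (d * ((L : ℝ) - 1))) * Real.sqrt n)
      K := by
  have hχ' : ∀ b b', unitDist (χ b) (χ b') = dist ((M.frame hL hΛ).src b).1 ((M.frame hL hΛ).src b').1 := by
    intro b b'; rw [hχ]; rfl
  have h := rep3185Dom_of_eq3169N (inΛ := fun y => ∃ b, χ b = y) (M.frame hL hΛ) T
    (M.length_frame_Γ_le hL hΛ) (fun x x' : ↥M.sites => dist x.1 x'.1) M.isPseudoDist_dist
    (M.frame_hdiam hL hΛ) (M.frame_hbond hL hΛ) (M.frame_hin hL hΛ) χ hχ' S hS hdom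
  have h2 : ((L : ℝ) - 1) + 1 = L := by ring
  rw [h2] at h
  exact h

/-- … hence (3.187) in the non-abelian model for all charted bond pairs: |C^{(k)}(Λ; χ b, χ b′)| ≤
K·B₁e^{2δ₁L}(1 + 4d(L − 1))²n·e^{−δ₁|b₋ − b′₋|} (n = dim 𝔤). [cite: Balaban1985BackgroundPropagators, (3.187) p.432] -/
theorem comb_bound_3187_N (hL : 0 < L) {Λ : Finset (Fin d → ℤ)} (hΛ : BlockClosed L Λ) (M : BondModel L Λ)
    (T : ↥M.bd → EuclideanSpace ℝ (Fin n) ≃ₗᵢ[ℝ] EuclideanSpace ℝ (Fin n))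
    {g : B9.Geometry} {Bg : B9.Backgrounds} {Ck : B9.SiteKernel g Bg} {unitDist : g.Site → g.Site → ℝ}
    {U : Bg.Cfg} {δ₁ B₁ K : ℝ} (hB₁ : 0 ≤ B₁) (hδ₁ : 0 ≤ δ₁) (hK : 0 ≤ K)
    (χ : ↥M.bd → g.Site) (hχ : ∀ b b', unitDist (χ b) (χ b') = dist b.1.1 b'.1.1)
    (S : Matrix (↥M.bd × Fin n) (↥M.bd × Fin n) ℝ)
    (hS : ∀ p q, |S p q| ≤ B₁ * Real.exp (-(δ₁ * unitDist (χ p.1) (χ q.1))))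
    (hdom : ∀ y y', (∃ b, χ b = y) → (∃ b, χ b = y') → ∃ p q : ↥M.bd × Fin n, χ p.1 = y ∧ χ q.1 = y' ∧
      |Ck.ker U y y'| ≤ K * |(EmatN (M.frame hL hΛ) T * S * (EmatN (M.frame hL hΛ) T)ᵀ) p q|)
    (b b' : ↥M.bd) :
    |Ck.ker U (χ b) (χ b')| ≤ K * (B₁ * Real.exp (2 * δ₁ * L) * ((1 + 4 * (d * ((L : ℝ) - 1))) * Real.sqrt n) *
      ((1 + 4 * (d * ((L : ℝ) - 1))) * Real.sqrt n)) * Real.exp (-(δ₁ * dist b.1.1 b'.1.1)) := by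
  rw [← hχ]
  exact bound_of_rep3185Dom hB₁ hδ₁ hK (comb_rep3185Dom_N hL hΛ M T χ hχ S hS hdom) (χ b) (χ b') ⟨b, rfl⟩
    ⟨b', rfl⟩

end Comb

end Literature.MathematicalPhysics.QuantumFieldTheory.Balaban1983to89.B9Eq3169MuN
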